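import Literature.AlgebraicGeometry.PlaneCurves.HessePencilCharacteristicThreeWebForm
import Literature.AlgebraicGeometry.PlaneCurves.HessePencilCharacteristicThreeWebSingular
import Literature.AlgebraicGeometry.PlaneCurves.HessianCovariance
import HarnessLib

/-!
# Remark 2.1: for `3 = 0` the web cubic `xy(ax + by + cz) + dz³` is nonsingular iff `abcd ≠ 0` (Artebani–Dolgachev)

Topic `Literature/AlgebraicGeometry/PlaneCurves`, namespace `Literature.AlgebraicGeometry.PlaneCurves`.
Lane `lit-hodgefound`, seat `lit-hodgefound-p37`, row g21-#11; closes the sentence of Remark 2.1 begun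
in `HessePencilCharacteristicThreeWebSingular` (g21-#10: `abc = 0 ⇒` singular) with the converse,
through `HessePencilCharacteristicThreeWebForm` (g21-#9: `F ∘ S = (d/c³)·E_t`, `t = c³/(abd)`),
`HessePencilCharacteristicThree` (g21-#1: `E_t` has a singular point iff `t = 0`) and
`HessianCovariance` (singular points correspond under an invertible substitution).  Everything here is
PROVED; no definition, no named fact.

Source — M. Artebani, I. Dolgachev, *The Hesse pencil of plane cubic curves*, Enseign. Math. (2) 55
(2009), §2, Remark 2.1 [`paper:arxiv-math_0611590` p0005 L60], VERBATIM: "We find equation (4) and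
check that it defines a nonsingular curve only if `abc ≠ 0`."

## What is here

* `web_singular_of_d_eq_zero` (any field): `d = 0 ⇒ (0, 0, 1)` is singular (`F = xy·ℓ`).
* **`web_nonsingular_of_three_eq_zero`** (any field with `3 = 0`): `abcd ≠ 0 ⇒` the web cubic has
  NO singular point with coordinates in `K`.
* **`web_singular_iff_of_three_eq_zero`** (`3 = 0`, `K = K̄`): the web cubic has a singular point iff
  `abcd = 0` — Remark 2.1's "nonsingular only if `abc ≠ 0`" together with its converse.

## References
* [ArtebaniDolgachev2009] M. Artebani, I. Dolgachev, *The Hesse pencil of plane cubic curves*,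
  Enseign. Math. (2) 55 (2009) 235–273, §2, Remark 2.1; Lemma 1, eq. (4).
* [Gibson1998] C. G. Gibson, *Elementary Geometry of Algebraic Curves*, CUP 1998, Lemma 13.2
  (singular points are projectively invariant).
-/

set_option autoImplicit false

open MvPolynomial Matrix
open Literature.AlgebraicGeometry.HyperbolicPolynomials

namespace Literature.AlgebraicGeometry.PlaneCurves

universe u

/-- The member `E_t = X³ + Y³ + Z³ + t·XYZ` (local notation, no definition). -/
local notation3 "𝐄[" t "]" =>
  (X 0 ^ 3 + X 1 ^ 3 + X 2 ^ 3 + C t * (X 0 * X 1 * X 2) : MvPolynomial (Fin 3) _)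

/-- The web cubic `F = xy(ax + by + cz) + dz³` (local notation, no definition). -/
local notation3 "𝐅[" a ", " b ", " c ", " d "]" =>
  (X 0 * X 1 * (C a * X 0 + C b * X 1 + C c * X 2) + C d * X 2 ^ 3 : MvPolynomial (Fin 3) _)

/-- `S = [[−a⁻¹, 0, 0], [0, −b⁻¹, 0], [c⁻¹, c⁻¹, c⁻¹]]` (g21-#9; local notation). -/
local notation3 "𝐒[" a ", " b ", " c "]" =>
  (Matrix.of ![![-a⁻¹, 0, 0], ![0, -b⁻¹, 0], ![c⁻¹, c⁻¹, c⁻¹]] : Matrix (Fin 3) (Fin 3) _)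

section CharThreeWebNonsingular

variable {K : Type u} [Field K]

/-- **`d = 0`: `(0, 0, 1)` is a singular point of `xy(ax + by + cz)`** (any field; the vertex
`x = y = 0` of the triangle of lines). [cite: ArtebaniDolgachev2009, §2, proof of Lemma 1 ("otherwise
the curve would be singular")] -/
theorem web_singular_of_d_eq_zero (a b c : K) :
    eval ![(0 : K), 0, 1] 𝐅[a, b, c, (0 : K)] = 0 ∧
      (fun i => eval ![(0 : K), 0, 1] (pderiv i 𝐅[a, b, c, (0 : K)])) = 0 := by
  rw [web_eval, web_eval_pderiv]
  constructor
  · simp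
  · funext i; fin_cases i <;> simp

/-- **`abcd ≠ 0 ⇒` the web cubic is nonsingular** (`3 = 0`, any field: no singular point with
coordinates in `K`): a singular point `p` of `F` gives the singular point `S⁻¹p` of
`F ∘ S = (d/c³)·E_t` (g21-#9), but `E_t`, `t = c³/(abd) ≠ 0`, is nonsingular (g21-#1).
[cite: ArtebaniDolgachev2009, §2, Remark 2.1] [cite: Gibson1998, Lemma 13.2] -/
theorem web_nonsingular_of_three_eq_zero (h3 : (3 : K) = 0) {a b c d : K} (ha : a ≠ 0) (hb : b ≠ 0)
    (hc : c ≠ 0) (hd : d ≠ 0) :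
    ¬ ∃ p : Fin 3 → K, p ≠ 0 ∧ eval p 𝐅[a, b, c, d] = 0 ∧
      (fun i => eval p (pderiv i 𝐅[a, b, c, d])) = 0 := by
  rintro ⟨p, hp, hF, hg⟩
  obtain ⟨hS, ht⟩ := web_bind₁_eq_smul_hesseE h3 ha hb hc hd
  have hκ : d * c⁻¹ ^ 3 ≠ 0 := mul_ne_zero hd (pow_ne_zero 3 (inv_ne_zero hc))
  have hSdet := (web_matrix_det ha hb hc (K := K)).2
  set q : Fin 3 → K := (𝐒[a, b, c] : Matrix (Fin 3) (Fin 3) K)⁻¹ *ᵥ p with hq_def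
  have hSq : (𝐒[a, b, c] : Matrix (Fin 3) (Fin 3) K) *ᵥ q = p := by
    rw [hq_def, Matrix.mulVec_mulVec, Matrix.mul_nonsing_inv _ (isUnit_iff_ne_zero.2 hSdet),
      Matrix.one_mulVec]
  have hq : q ≠ 0 := fun h => hp (by rw [← hSq, h, Matrix.mulVec_zero])
  -- `E_t(q) = 0`
  have hE : eval q (𝐄[c ^ 3 * (a * b * d)⁻¹] : MvPolynomial (Fin 3) K) = 0 := by
    have h1 : eval q (bind₁ (𝐒[a, b, c] : Matrix (Fin 3) (Fin 3) K).toMvPolynomial 𝐅[a, b, c, d]) = 0 := by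
      rw [eval_bind₁_toMvPolynomial, hSq, hF]
    rw [hS, smul_eval] at h1
    exact (mul_eq_zero.1 h1).resolve_left hκ
  -- `∇E_t(q) = 0`
  have hgE : (fun i => eval q (pderiv i (𝐄[c ^ 3 * (a * b * d)⁻¹] : MvPolynomial (Fin 3) K))) = 0 := by
    have h1 : (fun j => eval q (pderiv j
        (bind₁ (𝐒[a, b, c] : Matrix (Fin 3) (Fin 3) K).toMvPolynomial 𝐅[a, b, c, d]))) = 0 := by
      rw [grad_bind₁_toMvPolynomial_eq_zero_iff hSdet, hSq]; exact hg
    rw [hS] at h1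
    funext i
    have h2 := congrFun h1 i
    rw [Pi.zero_apply, Derivation.map_smul, smul_eval] at h2
    exact (mul_eq_zero.1 h2).resolve_left hκ
  exact ht ((hesseE_singular_iff_of_three_eq_zero h3 _).1 ⟨q, hq, hE, hgE⟩)

/-- **Artebani–Dolgachev, Remark 2.1, with its converse: for `3 = 0` over an algebraically closed
field, the web cubic `xy(ax + by + cz) + dz³` has a singular point iff `abcd = 0`.**
[cite: ArtebaniDolgachev2009, §2, Remark 2.1 ("(4) defines a nonsingular curve only if `abc ≠ 0`")] -/
theorem web_singular_iff_of_three_eq_zero [IsAlgClosed K] (h3 : (3 : K) = 0) (a b c d : K) :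
    (∃ p : Fin 3 → K, p ≠ 0 ∧ eval p 𝐅[a, b, c, d] = 0 ∧
      (fun i => eval p (pderiv i 𝐅[a, b, c, d])) = 0) ↔ a * b * c * d = 0 := by
  constructor
  · intro h
    by_contra hne
    have ha : a ≠ 0 := fun h0 => hne (by rw [h0]; ring)
    have hb : b ≠ 0 := fun h0 => hne (by rw [h0]; ring)
    have hc : c ≠ 0 := fun h0 => hne (by rw [h0]; ring)
    have hd : d ≠ 0 := fun h0 => hne (by rw [h0]; ring)
    exact web_nonsingular_of_three_eq_zero h3 ha hb hc hd h
  · intro h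
    rcases mul_eq_zero.1 h with habc | hd
    · exact web_singular_of_three_eq_zero h3 habc
    · subst hd
      exact ⟨![0, 0, 1], fun h0 => by simpa using congrFun h0 2, web_singular_of_d_eq_zero a b c⟩

end CharThreeWebNonsingular

end Literature.AlgebraicGeometry.PlaneCurves
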